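import Mathlib

/-!
# T5UnitaryContragredient — unitary representations: the conjugate is the contragredient
(N1 §ID-4(c))

Sub-step N1 of Tier 5 (route/T5-ID-p2.md, §ID-4(c)) passes from the `(0,1)`-vertex classes
of the characters `μ_c, μ_d` to the `(1,0)`-classes of the conjugate characters through the
sentence «`w_c = \overline{v_c′}` … the `(1,0)`-class of the COMPLEX-CONJUGATE representation
`\overline{π_c} ≅ π_c^∨` (unitary)».  This file records the elementary half of that sentence
in kernel form.  For a representation `ρ` of a group `G` on an inner product space `V` over
`𝕜` (`ℝ` or `ℂ`) by unitary operators (`IsUnitaryRep ρ`):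

* `inner_apply_left` — `⟪ρ g v, w⟫ = ⟪v, ρ g⁻¹ w⟫`;
* `innerₛₗ_apply_rep` — the conjugate-linear map `v ↦ ⟪v, ·⟫` (Mathlib's `innerₛₗ 𝕜`)
  intertwines `ρ` with the contragredient `ρ.dual` (`ρ.dual g f = f ∘ ρ g⁻¹`):
  `innerₛₗ 𝕜 (ρ g v) = ρ.dual g (innerₛₗ 𝕜 v)`;
* `innerₛₗ_injective` — it is injective, so the conjugate representation embeds in the
  contragredient;
* `innerₛₗ_bijective`, `conjDualEquiv`, `conjDualEquiv_rep` — in finite dimension it is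
  bijective: the conjugate representation IS the contragredient, through an explicit
  conjugate-linear equivalence `V ≃ₗ⋆[𝕜] V^*` commuting with the actions;
* `dual_innerₛₗ_apply_conj` — the matrix coefficients of `ρ.dual` on the image are the
  complex conjugates of those of `ρ`;
* `adjoint_eq_inv` — in finite dimension `ρ g⁻¹` is the adjoint of `ρ g`; `norm_apply`.

Nothing about the oscillator representation is formalised: Liu's Lemma D.1(2), which
computes `ω(μ, ε, χ)^∨ ≅ ω(μ^c, −ε, χ^{−1})`, is a cited input of N1 and is not restated.
-/

namespace Summit.Ventures.HodgeRepro2.T5UnitaryContragredient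

open scoped InnerProductSpace

noncomputable section

variable {𝕜 : Type*} [RCLike 𝕜] {V : Type*} [NormedAddCommGroup V] [InnerProductSpace 𝕜 V]
variable {G : Type*} [Group G]

/-- A representation acts by unitary operators: every `ρ g` preserves the inner product. -/
def IsUnitaryRep (ρ : Representation 𝕜 G V) : Prop :=
  ∀ (g : G) (v w : V), ⟪ρ g v, ρ g w⟫_𝕜 = ⟪v, w⟫_𝕜

variable {ρ : Representation 𝕜 G V}

/-- Unfolding lemma for `IsUnitaryRep`. -/
theorem IsUnitaryRep.inner_apply_apply (hρ : IsUnitaryRep ρ) (g : G) (v w : V) :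
    ⟪ρ g v, ρ g w⟫_𝕜 = ⟪v, w⟫_𝕜 := hρ g v w

/-- `ρ g (ρ g⁻¹ w) = w`. -/
theorem rep_apply_inv_apply (ρ : Representation 𝕜 G V) (g : G) (w : V) :
    ρ g (ρ g⁻¹ w) = w := by
  rw [← Module.End.mul_apply, ← map_mul, mul_inv_cancel, map_one, Module.End.one_apply]

/-- `ρ g⁻¹ (ρ g w) = w`. -/
theorem rep_inv_apply_apply (ρ : Representation 𝕜 G V) (g : G) (w : V) :
    ρ g⁻¹ (ρ g w) = w := by
  rw [← Module.End.mul_apply, ← map_mul, inv_mul_cancel, map_one, Module.End.one_apply]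

/-- For a unitary representation, `⟪ρ g v, w⟫ = ⟪v, ρ g⁻¹ w⟫`. -/
theorem IsUnitaryRep.inner_apply_left (hρ : IsUnitaryRep ρ) (g : G) (v w : V) :
    ⟪ρ g v, w⟫_𝕜 = ⟪v, ρ g⁻¹ w⟫_𝕜 := by
  conv_lhs => rw [← rep_apply_inv_apply ρ g w]
  exact hρ g v _

/-- For a unitary representation, `⟪v, ρ g w⟫ = ⟪ρ g⁻¹ v, w⟫`. -/
theorem IsUnitaryRep.inner_apply_right (hρ : IsUnitaryRep ρ) (g : G) (v w : V) :
    ⟪v, ρ g w⟫_𝕜 = ⟪ρ g⁻¹ v, w⟫_𝕜 := by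
  rw [hρ.inner_apply_left g⁻¹ v w, inv_inv]

/-- A unitary operator preserves the norm. -/
theorem IsUnitaryRep.norm_apply (hρ : IsUnitaryRep ρ) (g : G) (v : V) :
    ‖ρ g v‖ = ‖v‖ := by
  rw [@norm_eq_sqrt_re_inner 𝕜 _ _ _ _ (ρ g v), hρ g v v, ← @norm_eq_sqrt_re_inner 𝕜]

/-- **The intertwining identity.** The conjugate-linear map `v ↦ ⟪v, ·⟫` carries the action
of `ρ` to the contragredient action: `innerₛₗ 𝕜 (ρ g v) = ρ.dual g (innerₛₗ 𝕜 v)`. -/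
theorem innerₛₗ_apply_rep (hρ : IsUnitaryRep ρ) (g : G) (v : V) :
    innerₛₗ 𝕜 (ρ g v) = ρ.dual g (innerₛₗ 𝕜 v) := by
  ext w
  simp only [innerₛₗ_apply_apply, Representation.dual_apply, Module.Dual.transpose_apply,
    LinearMap.comp_apply]
  exact hρ.inner_apply_left g v w

/-- The matrix coefficients of the contragredient on the image of `innerₛₗ`. -/
theorem dual_innerₛₗ_apply (hρ : IsUnitaryRep ρ) (g : G) (v w : V) :
    ρ.dual g (innerₛₗ 𝕜 v) w = ⟪ρ g v, w⟫_𝕜 := by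
  rw [← innerₛₗ_apply_rep hρ, innerₛₗ_apply_apply]

/-- The matrix coefficients of the contragredient are the complex conjugates of those of `ρ`:
`(ρ.dual g ⟪v, ·⟫) w = conj ⟪w, ρ g v⟫`. -/
theorem dual_innerₛₗ_apply_conj (hρ : IsUnitaryRep ρ) (g : G) (v w : V) :
    ρ.dual g (innerₛₗ 𝕜 v) w = starRingEnd 𝕜 ⟪w, ρ g v⟫_𝕜 := by
  rw [dual_innerₛₗ_apply hρ, inner_conj_symm]

/-- The map `v ↦ ⟪v, ·⟫` is injective (the inner product is definite). -/
theorem innerₛₗ_injective :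
    Function.Injective (innerₛₗ 𝕜 : V →ₗ⋆[𝕜] Module.Dual 𝕜 V) := by
  intro v w h
  refine ext_inner_right 𝕜 fun u => ?_
  have := congrArg (fun f : Module.Dual 𝕜 V => f u) h
  simpa only [innerₛₗ_apply_apply] using this

/-- The image of `innerₛₗ` is stable under the contragredient action (it is the image of the
conjugate representation). -/
theorem exists_dual_innerₛₗ_eq (hρ : IsUnitaryRep ρ) (g : G) (v : V) :
    ∃ v' : V, ρ.dual g (innerₛₗ 𝕜 v) = innerₛₗ 𝕜 v' :=
  ⟨ρ g v, (innerₛₗ_apply_rep hρ g v).symm⟩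

section FiniteDimensional

variable [FiniteDimensional 𝕜 V]

/-- In finite dimension every linear functional is `⟪v, ·⟫` for some `v` (Riesz). -/
theorem innerₛₗ_surjective :
    Function.Surjective (innerₛₗ 𝕜 : V →ₗ⋆[𝕜] Module.Dual 𝕜 V) := by
  intro f
  haveI : CompleteSpace V := FiniteDimensional.complete 𝕜 V
  refine ⟨(InnerProductSpace.toDual 𝕜 V).symm (LinearMap.toContinuousLinearMap f), ?_⟩
  ext w
  rw [innerₛₗ_apply_apply, InnerProductSpace.toDual_symm_apply,
    LinearMap.coe_toContinuousLinearMap']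

/-- In finite dimension `v ↦ ⟪v, ·⟫` is a bijection `V → V^*`. -/
theorem innerₛₗ_bijective :
    Function.Bijective (innerₛₗ 𝕜 : V →ₗ⋆[𝕜] Module.Dual 𝕜 V) :=
  ⟨innerₛₗ_injective, innerₛₗ_surjective⟩

/-- The conjugate-linear equivalence `V ≃ₗ⋆[𝕜] V^*`, `v ↦ ⟪v, ·⟫`, in finite dimension. -/
def conjDualEquiv : V ≃ₗ⋆[𝕜] Module.Dual 𝕜 V :=
  LinearEquiv.ofBijective (innerₛₗ 𝕜) innerₛₗ_bijective

/-- Evaluation of `conjDualEquiv`. -/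
@[simp] theorem conjDualEquiv_apply_apply (v w : V) :
    (conjDualEquiv (𝕜 := 𝕜) v) w = ⟪v, w⟫_𝕜 := rfl

/-- **The conjugate representation is the contragredient.** In finite dimension the
conjugate-linear equivalence `conjDualEquiv : V ≃ₗ⋆[𝕜] V^*` intertwines a unitary `ρ` with
`ρ.dual`. -/
theorem conjDualEquiv_rep (hρ : IsUnitaryRep ρ) (g : G) (v : V) :
    conjDualEquiv (ρ g v) = ρ.dual g (conjDualEquiv (𝕜 := 𝕜) v) :=
  innerₛₗ_apply_rep hρ g v

/-- The inverse equivalence intertwines `ρ.dual` with `ρ`. -/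
theorem conjDualEquiv_symm_dual (hρ : IsUnitaryRep ρ) (g : G) (f : Module.Dual 𝕜 V) :
    (conjDualEquiv (𝕜 := 𝕜) (V := V)).symm (ρ.dual g f) = ρ g (conjDualEquiv.symm f) := by
  apply (conjDualEquiv (𝕜 := 𝕜) (V := V)).injective
  rw [LinearEquiv.apply_symm_apply, conjDualEquiv_rep hρ, LinearEquiv.apply_symm_apply]

/-- In finite dimension, `ρ g⁻¹` is the adjoint of `ρ g` for a unitary representation. -/
theorem IsUnitaryRep.adjoint_eq_inv (hρ : IsUnitaryRep ρ) (g : G) :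
    LinearMap.adjoint (ρ g) = ρ g⁻¹ := by
  symm
  rw [LinearMap.eq_adjoint_iff]
  intro x y
  rw [hρ.inner_apply_left g⁻¹ x y, inv_inv]

/-- Conversely, if `ρ g⁻¹` is the adjoint of `ρ g` for every `g`, the representation is
unitary. -/
theorem isUnitaryRep_of_adjoint_eq_inv (h : ∀ g : G, LinearMap.adjoint (ρ g) = ρ g⁻¹) :
    IsUnitaryRep ρ := by
  intro g v w
  rw [← LinearMap.adjoint_inner_right, h g, rep_inv_apply_apply]

end FiniteDimensional

end

end Summit.Ventures.HodgeRepro2.T5UnitaryContragredient
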